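import Mathlib
import Literature.NumberTheory.LFunctions.HurwitzZetaConstantTerm
import HarnessLib

/-!
# The `M(q)`-decomposition of a periodic Dirichlet series (Chatterjee–Murty 2014, §4), I: `re s > 1`

Topic `Literature/NumberTheory/LFunctions`; namespace `Literature.NumberTheory.LFunctions.ChatterjeeMurty2014`.
THEOREMS only (no definition, no named fact, no `sorry`); cell pub-zeta5, P1 g58. First of two files carrying the
analytic half of OKADA'S CRITERION for the vanishing of `L(1,f) = Σ_{n≥1} f(n)/n`, `f` periodic mod `q`, along

* T. Chatterjee, M. Ram Murty, *Non-vanishing of Dirichlet series with periodic coefficients*, J. Number Theory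
  **145** (2014) 1–21 [ChatterjeeMurty2014] (arXiv:1405.6982, READ), §4 «Variation of Okada's criterion», proof of
  Theorem 3: «Let `M(q)` be … the monoid generated by the prime factors of `q`. Then we have
  `L(s,f) = Σ_{n=1}^{∞} f(n)/n^s = Σ_{b∈M(q), (a,q)=1} f(ab)/(a^s b^s)`, since any natural number `n` can be factored
  uniquely as `n = ab` with `(a,q) = 1` and `b ∈ M(q)`. Thus `L(s,f) = Σ_{b∈M(q)} b^{−s} Σ_{(a,q)=1} f_b(a)/a^s`.
  Observe that `f_b` is a function supported on the coprime residue classes mod `q`»;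
* T. Okada, *On a certain infinite series for a periodic arithmetical function*, Acta Arith. **40** (1982) 143–153
  [Okada1982] (the criterion itself; the tree's scan is image-only, cited through [ChatterjeeMurty2014] Prop. 2 and
  R. Tijdeman, *Some applications of Diophantine approximation*, Number Theory for the Millennium III (2002)
  [Tijdeman2002], Appendix, Theorem 8 — both READ).

## What is here (`N ≥ 1`; `M(N)` = Mathlib's `Nat.factoredNumbers N.primeFactors` = the positive integers all of
whose prime factors divide `N`; `χ₀ = (1 : DirichletCharacter ℂ N)` = the indicator of the units of `ℤ/N`)

* `hasSum_factoredNumbers_rpow_neg`, `hasSum_factoredNumbers_inv` — `Σ_{m∈M(N)} m^{−σ} = Π_{p∣N}(1 − p^{−σ})⁻¹`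
  (`σ > 0`), **`Σ_{m∈M(N)} 1/m = N/φ(N)`**;
* `exists_factoredNumbers_mul_coprime`, `eq_of_factoredNumbers_mul_coprime_eq` — every `n ≥ 1` is uniquely `m·u`,
  `m ∈ M(N)`, `(u,N) = 1`;
* **`LSeries_eq_tsum_factoredNumbers`** — for `re s > 1`:
  `Σ_{n≥1} f(n)n^{−s} = Σ_{m∈M(N)} m^{−s} · L(s, χ₀·f(m·))` with Mathlib's `ZMod.LFunction`;
* `LSeriesSummable_indicator_factoredNumbers`, `LSeries_indicator_factoredNumbers_eq_tsum`,
  `hasDerivAt_LSeries_indicator_factoredNumbers`, `summable_factoredNumbers_cpow_mul` — the `M(N)`-supported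
  Dirichlet series `Σ_{m∈M(N)} c(m) m^{−s}` (bounded `c`): absolute convergence for `re s > 0`, value, derivative at
  `s = 1` (Mathlib `LSeries_hasDerivAt`).

The sequel `PeriodicDirichletSeriesSmoothPartLimit.lean` lets `s → 1⁺`. HONEST FRAMING: elementary/analytic
bookkeeping of a printed 2014 proof; nothing here concerns `ζ(5)`.
-/

noncomputable section

open Complex Finset Filter Topology

namespace Literature.NumberTheory.LFunctions

namespace ChatterjeeMurty2014

variable {N : ℕ} [NeZero N]

/-! ### Sums over `M(N)` = the positive integers composed of primes dividing `N` -/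

omit [NeZero N] in
/-- `Σ_{m ∈ M(N)} m^{−σ} = Π_{p ∣ N} (1 − p^{−σ})⁻¹` for `σ > 0`, absolutely convergent (a finite Euler product;
Mathlib `EulerProduct.summable_and_hasSum_factoredNumbers_prod_filter_prime_geometric`).
[cite: ChatterjeeMurty2014, §4 (proof of Theorem 3)] -/
theorem hasSum_factoredNumbers_rpow_neg {σ : ℝ} (hσ : 0 < σ) :
    HasSum (fun m : Nat.factoredNumbers N.primeFactors => ((m : ℕ) : ℝ) ^ (-σ))
      (∏ p ∈ N.primeFactors, (1 - (p : ℝ) ^ (-σ))⁻¹) := by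
  let g : ℕ →* ℝ :=
    { toFun := fun n => (n : ℝ) ^ (-σ)
      map_one' := by simp
      map_mul' := fun m n => by
        push_cast
        exact Real.mul_rpow (Nat.cast_nonneg m) (Nat.cast_nonneg n) }
  have hg : ∀ {p : ℕ}, p.Prime → ‖g p‖ < 1 := by
    intro p hp
    have hp1 : (1 : ℝ) < p := by exact_mod_cast hp.one_lt
    show ‖(p : ℝ) ^ (-σ)‖ < 1
    rw [Real.norm_of_nonneg (Real.rpow_nonneg (by positivity) _)]
    exact Real.rpow_lt_one_of_one_lt_of_neg hp1 (by linarith)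
  have h := (EulerProduct.summable_and_hasSum_factoredNumbers_prod_filter_prime_geometric hg
    N.primeFactors).2
  have hfilter : N.primeFactors.filter (fun p => p.Prime) = N.primeFactors :=
    Finset.filter_true_of_mem fun p hp => Nat.prime_of_mem_primeFactors hp
  rw [hfilter] at h
  exact h

omit [NeZero N] in
/-- `Σ_{m ∈ M(N)} m^{−σ}` converges for `σ > 0`. [cite: ChatterjeeMurty2014, §4] -/
theorem summable_factoredNumbers_rpow_neg {σ : ℝ} (hσ : 0 < σ) :
    Summable (fun m : Nat.factoredNumbers N.primeFactors => ((m : ℕ) : ℝ) ^ (-σ)) :=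
  (hasSum_factoredNumbers_rpow_neg hσ).summable

/-- **`Σ_{m ∈ M(N)} 1/m = N/φ(N)`** (`= Π_{p∣N} (1 − 1/p)⁻¹`, Euler's product for `φ`).
[cite: ChatterjeeMurty2015, §3 (proof of Proposition 3.1: «Σ_{b₁∈M(d)} 1/b₁ = Π_{p∣d}(1 − 1/p)⁻¹ = d/φ(d)»)] -/
theorem hasSum_factoredNumbers_inv :
    HasSum (fun m : Nat.factoredNumbers N.primeFactors => ((m : ℕ) : ℝ)⁻¹) ((N : ℝ) / N.totient) := by
  have h := hasSum_factoredNumbers_rpow_neg (N := N) one_pos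
  simp only [Real.rpow_neg_one] at h
  convert h using 1
  have hφ : ((N.totient : ℕ) : ℝ) = N * ∏ p ∈ N.primeFactors, (1 - (p : ℝ)⁻¹) := by
    have := Nat.totient_eq_mul_prod_factors N
    exact_mod_cast congrArg (fun x : ℚ => (x : ℝ)) this |>.trans (by push_cast; rfl)
  rw [hφ, Finset.prod_inv_distrib]
  have hN : (N : ℝ) ≠ 0 := by exact_mod_cast NeZero.ne N
  have hprod : ∏ p ∈ N.primeFactors, (1 - (p : ℝ)⁻¹) ≠ 0 := by
    refine Finset.prod_ne_zero_iff.mpr fun p hp => ?_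
    have hp1 : (1 : ℝ) < p := by exact_mod_cast (Nat.prime_of_mem_primeFactors hp).one_lt
    have : (p : ℝ)⁻¹ < 1 := inv_lt_one_of_one_lt₀ hp1
    linarith
  field_simp

/-- `Σ_{m ∈ M(N)} 1/m` converges (to `N/φ(N)`).
[cite: ChatterjeeMurty2015, §3 (proof of Proposition 3.1)] -/
theorem summable_factoredNumbers_inv :
    Summable (fun m : Nat.factoredNumbers N.primeFactors => ((m : ℕ) : ℝ)⁻¹) :=
  hasSum_factoredNumbers_inv.summable


/-! ### The decomposition `n = m·u`, `m ∈ M(N)`, `(u, N) = 1` -/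

/-- Every `n ≥ 1` is `m·u` with `m ∈ M(N)` and `(u, N) = 1` («any natural number `n` can be factored uniquely as
`n = ab` with `(a,q) = 1` and `b ∈ M(q)`», existence half; by peeling off one prime of `N` at a time).
[cite: ChatterjeeMurty2014, §4 (proof of Theorem 3)] -/
theorem exists_factoredNumbers_mul_coprime (n : ℕ) (hn : n ≠ 0) :
    ∃ m ∈ Nat.factoredNumbers N.primeFactors, ∃ u : ℕ, u.Coprime N ∧ m * u = n := by
  induction n using Nat.strong_induction_on with
  | _ n ih =>
  by_cases hc : n.Coprime N
  · refine ⟨1, ?_, n, hc, one_mul n⟩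
    exact Nat.mem_factoredNumbers'.mpr fun p hp hp1 => (hp.ne_one (Nat.dvd_one.mp hp1)).elim
  · obtain ⟨p, hp, hpn, hpN⟩ := Nat.Prime.not_coprime_iff_dvd.mp hc
    obtain ⟨k, rfl⟩ := hpn
    have hk : k ≠ 0 := fun h => hn (by rw [h, mul_zero])
    have hlt : k < p * k := by
      have := hp.two_le
      have hkpos := Nat.pos_of_ne_zero hk
      nlinarith
    obtain ⟨m', hm', u, hu, hmu⟩ := ih k hlt hk
    refine ⟨p * m', Nat.mul_mem_factoredNumbers ?_ hm', u, hu, by rw [mul_assoc, hmu]⟩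
    exact Nat.mem_factoredNumbers'.mpr fun r hr hrp =>
      (Nat.prime_dvd_prime_iff_eq hr hp).mp hrp ▸ Nat.mem_primeFactors.mpr ⟨hp, hpN, NeZero.ne N⟩

omit [NeZero N] in
/-- An `M(N)`-number is coprime to every integer coprime to `N`. [folklore] -/
private theorem coprime_of_mem_factoredNumbers {m u : ℕ} (hm : m ∈ Nat.factoredNumbers N.primeFactors)
    (hu : u.Coprime N) : m.Coprime u := by
  refine Nat.coprime_of_dvd fun k hk hkm hku => ?_
  have hkN : k ∣ N := Nat.dvd_of_mem_primeFactors (Nat.mem_factoredNumbers'.mp hm k hk hkm)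
  have h1 : k ∣ Nat.gcd u N := Nat.dvd_gcd hku hkN
  rw [Nat.Coprime.gcd_eq_one hu] at h1
  exact hk.ne_one (Nat.dvd_one.mp h1)

omit [NeZero N] in
/-- Uniqueness half of the factorisation `n = m·u`: `(m, u) ↦ m·u` is injective on `M(N) × {(u,N) = 1}`.
[cite: ChatterjeeMurty2014, §4 (proof of Theorem 3)] -/
theorem eq_of_factoredNumbers_mul_coprime_eq {m₁ m₂ u₁ u₂ : ℕ}
    (hm₁ : m₁ ∈ Nat.factoredNumbers N.primeFactors) (hm₂ : m₂ ∈ Nat.factoredNumbers N.primeFactors)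
    (hu₁ : u₁.Coprime N) (hu₂ : u₂.Coprime N) (h : m₁ * u₁ = m₂ * u₂) : m₁ = m₂ ∧ u₁ = u₂ := by
  have h12 : m₁ ∣ m₂ :=
    (coprime_of_mem_factoredNumbers hm₁ hu₂).dvd_of_dvd_mul_right (h ▸ Dvd.intro u₁ rfl)
  have h21 : m₂ ∣ m₁ :=
    (coprime_of_mem_factoredNumbers hm₂ hu₁).dvd_of_dvd_mul_right (h.symm ▸ Dvd.intro u₂ rfl)
  have hm : m₁ = m₂ := Nat.dvd_antisymm h12 h21
  subst hm
  exact ⟨rfl, Nat.eq_of_mul_eq_mul_left (Nat.pos_of_ne_zero hm₁.1) h⟩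

/-! ### The smooth decomposition of `L(s, f)` for `re s > 1` -/

omit [NeZero N] in
/-- The term-wise identity behind the decomposition: for `m ∈ M(N)` and `(u, N) = 1`,
`f(mu)/(mu)^s = m^{−s} · [χ₀(u) f(m·u)/u^s]` with `χ₀` the principal character mod `N` (`χ₀(u) = 1`).
[cite: ChatterjeeMurty2014, §4 (proof of Theorem 3)] -/
theorem term_mul_eq (f : ZMod N → ℂ) (s : ℂ) {m u : ℕ} (hm : m ≠ 0) (hu : u.Coprime N) :
    LSeries.term (fun n : ℕ => f n) s (m * u) =
      ((m : ℕ) : ℂ) ^ (-s) *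
        LSeries.term (fun n : ℕ => (1 : DirichletCharacter ℂ N) (n : ZMod N) * f ((m : ℕ) * (n : ZMod N))) s u := by
  rcases eq_or_ne u 0 with rfl | hu0
  · simp [LSeries.term_zero]
  have hmu : m * u ≠ 0 := mul_ne_zero hm hu0
  have hunit : IsUnit ((u : ℕ) : ZMod N) := (ZMod.isUnit_iff_coprime u N).mpr hu
  rw [LSeries.term_of_ne_zero hmu, LSeries.term_of_ne_zero hu0, MulChar.one_apply hunit, one_mul,
    Nat.cast_mul, Nat.cast_mul, Complex.natCast_mul_natCast_cpow, cpow_neg]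
  have hms : ((m : ℕ) : ℂ) ^ s ≠ 0 := by
    rw [Ne, Complex.cpow_eq_zero_iff, not_and_or]
    exact Or.inl (by exact_mod_cast hm)
  field_simp

/-- **The `M(N)`-decomposition of a periodic Dirichlet series** («`L(s,f) = Σ_{b∈M(q)} b^{−s} Σ_{(a,q)=1}
f(ab)a^{−s} = Σ_{b∈M(q)} b^{−s} Σ_{(a,q)=1} f_b(a) a^{−s}` … `f_b` is a function supported on the coprime
residue classes mod `q`»): for `f : ℤ/N → ℂ` and `re s > 1`,
`Σ_{n≥1} f(n) n^{−s} = Σ_{m∈M(N)} m^{−s} · L(s, χ₀·f(m·))`, where `χ₀·f(m·)` is the function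
`j ↦ χ₀(j) f(mj)` on `ℤ/N` (`χ₀` = principal character = indicator of the units) and `L(s, ·)` is Mathlib's
`ZMod.LFunction` (= its Dirichlet series here). [cite: ChatterjeeMurty2014, §4 (proof of Theorem 3, first display)] -/
theorem LSeries_eq_tsum_factoredNumbers (f : ZMod N → ℂ) {s : ℂ} (hs : 1 < s.re) :
    LSeries (fun n : ℕ => f n) s = ∑' m : Nat.factoredNumbers N.primeFactors,
      ((m : ℕ) : ℂ) ^ (-s) *
        ZMod.LFunction (fun j => (1 : DirichletCharacter ℂ N) j * f ((m : ℕ) * j)) s := by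
  set F : ℕ → ℂ := fun n => f n with hF
  -- the injection `(m, u) ↦ m u`
  let g : Nat.factoredNumbers N.primeFactors × {u : ℕ // u.Coprime N} → ℕ := fun x => (x.1 : ℕ) * (x.2 : ℕ)
  have hg : Function.Injective g := by
    rintro ⟨⟨m₁, hm₁⟩, ⟨u₁, hu₁⟩⟩ ⟨⟨m₂, hm₂⟩, ⟨u₂, hu₂⟩⟩ h
    obtain ⟨h1, h2⟩ := eq_of_factoredNumbers_mul_coprime_eq hm₁ hm₂ hu₁ hu₂ h
    subst h1; subst h2; rfl
  have hrange : Function.support (LSeries.term F s) ⊆ Set.range g := by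
    intro n hn
    have hn0 : n ≠ 0 := by
      rintro rfl
      exact hn (LSeries.term_zero F s)
    obtain ⟨m, hm, u, hu, hmu⟩ := exists_factoredNumbers_mul_coprime (N := N) n hn0
    exact ⟨(⟨m, hm⟩, ⟨u, hu⟩), hmu⟩
  have hrange' : ∀ x ∉ Set.range g, LSeries.term F s x = 0 :=
    fun x hx => Classical.not_not.mp fun h => hx (hrange h)
  have hsum : Summable (LSeries.term F s) := ZMod.LSeriesSummable_of_one_lt_re f hs
  have hsum' : Summable (fun x => LSeries.term F s (g x)) := by
    simpa only [Function.comp_def] using (hg.summable_iff hrange').mpr hsum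
  rw [LSeries, ← hg.tsum_eq hrange, Summable.tsum_prod hsum']
  refine tsum_congr fun m => ?_
  have hm0 : (m : ℕ) ≠ 0 := m.2.1
  -- the inner sum over `(u, N) = 1`
  have hinner : ∀ u : {u : ℕ // u.Coprime N}, LSeries.term F s (g (m, u)) =
      ((m : ℕ) : ℂ) ^ (-s) *
        LSeries.term (fun n : ℕ => (1 : DirichletCharacter ℂ N) (n : ZMod N) * f ((m : ℕ) * (n : ZMod N))) s u :=
    fun u => term_mul_eq f s hm0 u.2
  rw [tsum_congr hinner, tsum_mul_left, ZMod.LFunction_eq_LSeries _ hs, LSeries]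
  congr 1
  -- `Σ_{(u,N)=1} = Σ_{u}`: the terms vanish off the units
  refine tsum_subtype_eq_of_support_subset (s := {u : ℕ | u.Coprime N}) fun u hu => ?_
  by_contra hcop
  apply hu
  rcases eq_or_ne u 0 with rfl | hu0
  · exact LSeries.term_zero _ s
  rw [LSeries.term_of_ne_zero hu0,
    MulChar.map_nonunit _ (mt (ZMod.isUnit_iff_coprime u N).mp hcop), zero_mul, zero_div]


/-! ### Dirichlet series supported on `M(N)` -/

set_option maxHeartbeats 400000 in
omit [NeZero N] in
/-- A Dirichlet series `Σ_{m∈M(N)} c(m) m^{−s}` with bounded coefficients converges absolutely for every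
`re s > 0` (its terms are dominated by `B·m^{−re s}` on `M(N)`). [cite: ChatterjeeMurty2014, §4 (proof of Theorem 3)] -/
theorem LSeriesSummable_indicator_factoredNumbers {c : ℕ → ℂ} {B : ℝ} (hc : ∀ n, ‖c n‖ ≤ B) {s : ℂ}
    (hs : 0 < s.re) : LSeriesSummable ((Nat.factoredNumbers N.primeFactors).indicator c) s := by
  have hsum : Summable fun n : ℕ =>
      B * (Nat.factoredNumbers N.primeFactors).indicator (fun n : ℕ => (n : ℝ) ^ (-s.re)) n :=
    (summable_subtype_iff_indicator.mp (summable_factoredNumbers_rpow_neg (N := N) hs)).mul_left B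
  refine Summable.of_norm_bounded hsum fun n => ?_
  by_cases hn : n ∈ Nat.factoredNumbers N.primeFactors
  · have hn0 : n ≠ 0 := hn.1
    rw [Set.indicator_of_mem hn, LSeries.term_of_ne_zero hn0, Set.indicator_of_mem hn, norm_div,
      Complex.norm_natCast_cpow_of_pos (Nat.pos_of_ne_zero hn0), Real.rpow_neg (Nat.cast_nonneg n),
      div_eq_mul_inv]
    exact mul_le_mul_of_nonneg_right (hc n) (inv_nonneg.mpr (Real.rpow_nonneg (Nat.cast_nonneg n) _))
  · rw [Set.indicator_of_notMem hn, mul_zero]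
    rcases eq_or_ne n 0 with rfl | hn0
    · rw [LSeries.term_zero, norm_zero]
    · rw [LSeries.term_of_ne_zero hn0, Set.indicator_of_notMem hn, zero_div, norm_zero]

omit [NeZero N] in
/-- The value of an `M(N)`-supported Dirichlet series as a sum over `M(N)`:
`Σ_{n≥1} 𝟙_{M(N)}(n) c(n) n^{−s} = Σ_{m∈M(N)} m^{−s} c(m)`. [cite: ChatterjeeMurty2014, §4 (proof of Theorem 3)] -/
theorem LSeries_indicator_factoredNumbers_eq_tsum (c : ℕ → ℂ) (s : ℂ) :
    LSeries ((Nat.factoredNumbers N.primeFactors).indicator c) s =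
      ∑' m : Nat.factoredNumbers N.primeFactors, ((m : ℕ) : ℂ) ^ (-s) * c m := by
  rw [LSeries, tsum_subtype (Nat.factoredNumbers N.primeFactors) (fun n : ℕ => ((n : ℕ) : ℂ) ^ (-s) * c n)]
  refine tsum_congr fun n => ?_
  by_cases hn : n ∈ Nat.factoredNumbers N.primeFactors
  · rw [Set.indicator_of_mem hn, LSeries.term_of_ne_zero hn.1, Set.indicator_of_mem hn, cpow_neg,
      div_eq_inv_mul]
  · rw [Set.indicator_of_notMem hn]
    rcases eq_or_ne n 0 with rfl | hn0
    · rw [LSeries.term_zero]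
    · rw [LSeries.term_of_ne_zero hn0, Set.indicator_of_notMem hn, zero_div]

omit [NeZero N] in
/-- `log · (𝟙_{M(N)} c) = 𝟙_{M(N)} (log · c)`: the logarithmic twist of an `M(N)`-supported series is
`M(N)`-supported. [folklore] -/
private theorem logMul_indicator (c : ℕ → ℂ) :
    LSeries.logMul ((Nat.factoredNumbers N.primeFactors).indicator c) =
      (Nat.factoredNumbers N.primeFactors).indicator (fun n : ℕ => Complex.log n * c n) := by
  funext n
  by_cases hn : n ∈ Nat.factoredNumbers N.primeFactors
  · rw [LSeries.logMul, Set.indicator_of_mem hn, Set.indicator_of_mem hn]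
  · rw [LSeries.logMul, Set.indicator_of_notMem hn, Set.indicator_of_notMem hn, mul_zero]

omit [NeZero N] in
/-- **Term-wise differentiation of an `M(N)`-supported Dirichlet series at `s = 1`**: with bounded
coefficients `c`, `s ↦ Σ_{m∈M(N)} c(m) m^{−s}` has derivative `−Σ_{m∈M(N)} (log m) c(m)/m` at `s = 1` (Mathlib
`LSeries_hasDerivAt`; the abscissa of absolute convergence is `≤ 1/2 < 1`).
[cite: ChatterjeeMurty2014, §4 (proof of Theorem 3: «`b^{−s} = (1/b){1 − (s−1) log b + ⋯}`»)] -/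
theorem hasDerivAt_LSeries_indicator_factoredNumbers {c : ℕ → ℂ} {B : ℝ} (hc : ∀ n, ‖c n‖ ≤ B) :
    HasDerivAt (LSeries ((Nat.factoredNumbers N.primeFactors).indicator c))
      (-∑' m : Nat.factoredNumbers N.primeFactors, ((m : ℕ) : ℂ) ^ (-(1 : ℂ)) * (Complex.log m * c m)) 1 := by
  have habs : LSeries.abscissaOfAbsConv ((Nat.factoredNumbers N.primeFactors).indicator c) < (1 : ℂ).re := by
    have h := (LSeriesSummable_indicator_factoredNumbers (N := N) hc (s := (1 / 2 : ℂ))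
      (by norm_num)).abscissaOfAbsConv_le
    refine lt_of_le_of_lt h ?_
    have h12 : ((1 / 2 : ℂ)).re = 1 / 2 := by norm_num
    rw [h12, Complex.one_re]
    exact_mod_cast (show (1 / 2 : ℝ) < 1 by norm_num)
  have h := LSeries_hasDerivAt habs
  rwa [logMul_indicator, LSeries_indicator_factoredNumbers_eq_tsum] at h


omit [NeZero N] in
/-- `Σ_{m∈M(N)} m^{−s} c(m)` converges absolutely for bounded `c` and `re s > 0`.
[cite: ChatterjeeMurty2014, §4 (proof of Theorem 3)] -/
theorem summable_factoredNumbers_cpow_mul {c : ℕ → ℂ} {B : ℝ} (hc : ∀ n, ‖c n‖ ≤ B) {s : ℂ} (hs : 0 < s.re) :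
    Summable (fun m : Nat.factoredNumbers N.primeFactors => ((m : ℕ) : ℂ) ^ (-s) * c m) := by
  refine Summable.of_norm_bounded ((summable_factoredNumbers_rpow_neg (N := N) hs).mul_right B) fun m => ?_
  rw [norm_mul, Complex.norm_natCast_cpow_of_pos (Nat.pos_of_ne_zero m.2.1), neg_re]
  exact mul_le_mul_of_nonneg_left (hc m) (Real.rpow_nonneg (Nat.cast_nonneg _) _)

end ChatterjeeMurty2014

end Literature.NumberTheory.LFunctions

end
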